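import Literature.AlgebraicGeometry.AbelianSchemes.AbelianSchemeGroupLawLifts
import Literature.AlgebraicGeometry.AbelianSchemes.AbelianSchemeLiftOfLaw
import HarnessLib

/-!
# A smooth proper lift of an abelian scheme across a small extension of Artin local rings IS an abelian scheme
# ([MumfordFogartyKirwan1994] Ch. 6 §3 Prop. 6.15 — both halves assembled)

Topic `Literature/AlgebraicGeometry/AbelianSchemes`; namespace `Literature.AlgebraicGeometry.AbelianSchemes.AbelianSchemeOver`.
THEOREMS ONLY (no definition, no named fact, no instance, no notation, no `sorry`; net Literature debt 0).
Cell hodgecm-mathlib (D-0151), F-11 (A4b) ∕ F-4 II-a: the JUNCTION of the existence half (E) ★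
`exists_mul_lift_of_isPullback_specMap_mk` (B-p01 (g16), `AbelianSchemeGroupLawLifts`: SGA1 III 5.1 obstruction + Künneth along the
unit slices — needs `𝔪·J = 0`) with the group-law half (G) ★ `exists_grpObj_isBaseChangeVia_of_lift` ∕ ★
`exists_abelianSchemeOver_of_isPullback_of_liftLaw` (B-p04 (g22): shears, rigidity, group object, relative dimension).
HC_CM is proved only modulo the 7 printed citations until rung 0 closes; this file discharges none of them.

* **`exists_grpObj_isBaseChangeVia_of_section`** — `A` Artin local, `J ≠ ⊤`, `𝔪·J = 0`; `X → Spec A` proper smooth with a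
  section `ε`; `A₀` an abelian scheme over `Spec (A⧸J)` with a cartesian `G : A₀.X → X` matching units ⇒ `X` carries a group law
  with unit `ε` making it an abelian scheme of which `A₀` is the base change (★ `IsBaseChangeVia`) — the F-4 letter `stub_IIa`;
* **`exists_abelianSchemeOver_of_isPullback`** — the same without a chosen section, with the relative dimension: an abelian
  scheme structure on `X` of relative dimension `g = reldim A₀` — the F-11 α1∕(A4) input «an abelian lift exists».

## References
* [MumfordFogartyKirwan1994] D. Mumford, J. Fogarty, F. Kirwan, *Geometric Invariant Theory*, 3rd ed. (1994), Ch. 6 §3 Prop. 6.15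
  (p. 124) and its proof (p. 125).
-/

noncomputable section

set_option backward.isDefEq.respectTransparency false

open CategoryTheory CategoryTheory.Limits AlgebraicGeometry MonoidalCategory CartesianMonoidalCategory
open scoped MonObj

namespace Literature.AlgebraicGeometry.AbelianSchemes.AbelianSchemeOver

variable {A : Type} [CommRing A] [IsArtinianRing A] [IsLocalRing A] {J : Ideal A} (hJ : J ≠ ⊤)
  (hmJ : IsLocalRing.maximalIdeal A * J = ⊥) {A₀ : AbelianSchemeOver (Spec (.of (A ⧸ J)))} {X : Over (Spec (.of A))}
  {G : A₀.X.left ⟶ X.left} (hG : IsPullback G A₀.X.hom X.hom (Spec.map (CommRingCat.ofHom (Ideal.Quotient.mk J))))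

include hJ hmJ hG in
/-- **[MumfordFogartyKirwan1994] Prop. 6.15 with a chosen unit**: over an Artin local `A` with `J ≠ ⊤`, `𝔪·J = 0`, a proper smooth
`X → Spec A` with a section `ε`, and an abelian scheme `A₀ ∕ Spec (A⧸J)` with a cartesian `G : A₀.X → X` under which the unit of
`A₀` reduces `ε`, the scheme `X` carries a group-object structure with unit `ε` making it an abelian scheme of which `A₀` is the
base change along `G` (★ `IsBaseChangeVia`).  (E) ★ `exists_mul_lift_of_isPullback_specMap_mk` ∘ (G) ★
`exists_grpObj_isBaseChangeVia_of_lift`. [cite: MumfordFogartyKirwan1994, Ch. 6 §3 Proposition 6.15 (p. 124), proof (p. 125)] -/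
theorem exists_grpObj_isBaseChangeVia_of_section [IsProper X.hom] [Smooth X.hom] (ε : Spec (.of A) ⟶ X.left)
    (hε₁ : ε ≫ X.hom = 𝟙 _) (hε : η[A₀.X].left ≫ G = Spec.map (CommRingCat.ofHom (Ideal.Quotient.mk J)) ≫ ε) :
    ∃ (GX : GrpObj X) (hgc : GeometricallyConnected X.hom), (@MonObj.one _ _ _ X GX.toMonObj).left = ε ∧
      A₀.IsBaseChangeVia (@AbelianSchemeOver.mk _ X GX ‹IsProper X.hom› ‹Smooth X.hom› hgc)
        (Spec.map (CommRingCat.ofHom (Ideal.Quotient.mk J))) G := by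
  obtain ⟨m, hm⟩ := exists_mul_lift_of_isPullback_specMap_mk A J hJ hmJ X A₀ G hG
  exact exists_grpObj_isBaseChangeVia_of_lift hJ hG ε hε₁ hε m hm

include hJ hmJ hG in
/-- **[MumfordFogartyKirwan1994] Prop. 6.15, the moduli consumer shape**: over an Artin local `A` with `J ≠ ⊤`, `𝔪·J = 0`, an
abelian scheme `A₀ ∕ Spec (A⧸J)` of relative dimension `g` and a proper smooth `X → Spec A` with a cartesian `G : A₀.X → X`
⇒ `X` carries an abelian-scheme structure of relative dimension `g` of which `A₀` is the base change along `G`.  No section and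
no characteristic hypothesis.  (E) ★ `exists_mul_lift_of_isPullback_specMap_mk` ∘ ★ `exists_abelianSchemeOver_of_isPullback_of_liftLaw`.
[cite: MumfordFogartyKirwan1994, Ch. 6 §3 Proposition 6.15 (p. 124), proof (p. 125)] -/
theorem exists_abelianSchemeOver_of_isPullback [IsProper X.hom] [Smooth X.hom] {g : ℕ} (hg : A₀.IsOfRelDim g) :
    ∃ (GX : GrpObj X) (hgc : GeometricallyConnected X.hom),
      (@AbelianSchemeOver.mk _ X GX ‹IsProper X.hom› ‹Smooth X.hom› hgc).IsOfRelDim g ∧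
      A₀.IsBaseChangeVia (@AbelianSchemeOver.mk _ X GX ‹IsProper X.hom› ‹Smooth X.hom› hgc)
        (Spec.map (CommRingCat.ofHom (Ideal.Quotient.mk J))) G := by
  obtain ⟨m, hm⟩ := exists_mul_lift_of_isPullback_specMap_mk A J hJ hmJ X A₀ G hG
  exact exists_abelianSchemeOver_of_isPullback_of_liftLaw hJ hG hg m hm

end Literature.AlgebraicGeometry.AbelianSchemes.AbelianSchemeOver

end
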